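import Literature.NumberTheory.Sieve.LinearEquationsInPrimesQualitative
import Literature.NumberTheory.Sieve.PrimeParallelograms
import Literature.NumberTheory.Sieve.LinearEquationsInPrimesLevelTwoAllSystems
import HarnessLib

/-!
# Green–Tao 2010, Examples 3 and 9: IP₀ cubes — all subset sums one less (or more) than a prime

Topic `Literature/NumberTheory/Sieve`. Source: B. Green, T. Tao, *Linear equations in primes*,
Ann. of Math. 171 (2010), §1 (arXiv:math/0606088 pp. 5 and 8):

> **Example 3 (IP₀ cubes).** Let `d ≥ 1` and `t := 2^d − 1`. Then the system
> `Ψ(n₁, …, n_d) := (∑_{i ∈ A} nᵢ)_{A ⊆ [d], A ≠ ∅}` also has a large value of `t` but has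
> complexity at most `d − 1`.

> **Example 9 (`P − 1` and `P + 1` are IP₀-sets).** Assume `s ≥ 0` is such that the `GI(s)` and
> `MN(s)` conjectures are true. Then (thanks to Example 3) there exist infinitely many
> `s+1`-tuples `(n₁, …, n_{s+1})` of distinct positive integers such that all of the sums
> `{∑_{i∈A} nᵢ : A ⊆ [s+1], A ≠ ∅}` are equal to a prime minus `1`. Similarly for the primes plus
> `1`. In particular, we unconditionally have the new result that there are infinitely many
> distinct `n₁, n₂, n₃` such that `n₁, n₂, n₃, n₁+n₂, n₁+n₃, n₂+n₃, n₁+n₂+n₃` are all one less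
> than a prime.

Kernel form. `ipSystem d c = (∑_{i∈A} nᵢ + c)_{A ≠ ∅}` (`t = ipCount d = 2^d − 1` forms,
`ipCount_eq`); **Example 3** is `complexity_ipSystem_le : complexity (ipSystem d c) ≤ d − 1`, by
the explicit avoiding cover: for the form `ψ_S`, the `d` classes `{ψ_T : i ∉ T}` (`i ∈ S`,
witness `eᵢ`) and `{ψ_T : T ⊇ S, i ∈ T}` (`i ∉ S`, witness `e_a − eᵢ`, `a ∈ S`). **Example 9** is
`GreenTao2010_example9`: from the Main Theorem at complexity `d − 1`
(`GreenTao2010_mainTheoremAtComplexity (d-1)`, through which `GI(d−1)`, `MN(d−1)` enter; engine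
`GreenTao2010_corollary19_of_mainTheoremAtComplexity` = Cor. 1.9) there are infinitely many
`0 < n₁ < ⋯ < n_d` with every `∑_{i∈A} nᵢ + c` prime (`c = ±1`). Instances: `d = 2`
UNCONDITIONAL (`GreenTao2010_example9_two`: infinitely many `0 < n₁ < n₂` with
`n₁ + c, n₂ + c, n₁ + n₂ + c` prime), and `d = 3` — the displayed "new result" — from the named
facts `GITwo`, `MNTwo` (Green–Tao's own inverse `U³` and Möbius–nilsequences theorems, the tree's
hypotheses of `GreenTao2010_mainTheoremAtComplexity_two_of_GI_of_MN`):
`GreenTao2010_example9_three_of_GI_of_MN`.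

## References

* [GreenTao2010] B. Green, T. Tao, *Linear equations in primes*, Ann. of Math. (2) 171 (2010),
  §1 Examples 3 and 9, Def. 1.5, Cor. 1.9.
-/

noncomputable section

open Finset

namespace Literature.NumberTheory.Sieve

variable {d : ℕ}

/-! ### The IP₀ system -/

/-- `t = #{A ⊆ [d] : A ≠ ∅}`, the number of forms. [cite: GreenTao2010, Example 3] -/
def ipCount (d : ℕ) : ℕ := Fintype.card {A : Finset (Fin d) // A.Nonempty}

/-- `t = 2^d − 1`. [cite: GreenTao2010, Example 3] -/
theorem ipCount_eq (d : ℕ) : ipCount d = 2 ^ d - 1 := by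
  classical
  unfold ipCount
  rw [Fintype.card_subtype, show (univ.filter fun A : Finset (Fin d) => A.Nonempty) = univ.erase ∅ by
      ext A; simp [Finset.nonempty_iff_ne_empty],
    Finset.card_erase_of_mem (Finset.mem_univ _), Finset.card_univ, Fintype.card_finset,
    Fintype.card_fin]

/-- A fixed enumeration of the nonempty subsets of `[d]`. [cite: GreenTao2010, Example 3] -/
def ipSet (k : Fin (ipCount d)) : Finset (Fin d) :=
  ((Fintype.equivFin {A : Finset (Fin d) // A.Nonempty}).symm k).1

/-- The enumerated sets are nonempty. [cite: GreenTao2010, Example 3] -/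
theorem ipSet_nonempty (k : Fin (ipCount d)) : (ipSet k).Nonempty :=
  ((Fintype.equivFin {A : Finset (Fin d) // A.Nonempty}).symm k).2

/-- The enumeration is injective. [cite: GreenTao2010, Example 3] -/
theorem ipSet_injective : Function.Injective (ipSet (d := d)) :=
  Subtype.val_injective.comp (Fintype.equivFin _).symm.injective

/-- Every nonempty subset is enumerated. [cite: GreenTao2010, Example 3] -/
theorem exists_ipSet_eq {A : Finset (Fin d)} (hA : A.Nonempty) : ∃ k : Fin (ipCount d), ipSet k = A :=
  ⟨Fintype.equivFin _ ⟨A, hA⟩, by simp [ipSet]⟩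

/-- There is at least one form when `d ≥ 1`. [cite: GreenTao2010, Example 3] -/
theorem one_le_ipCount (hd : 1 ≤ d) : 1 ≤ ipCount d :=
  Fintype.card_pos_iff.mpr ⟨⟨{⟨0, hd⟩}, Finset.singleton_nonempty _⟩⟩

/-- The form `∑_{i ∈ A} nᵢ + c` on `ℤ^d`. [cite: GreenTao2010, Examples 3 and 9] -/
def subsetSumForm (A : Finset (Fin d)) (c : ℤ) : AffLinForm d :=
  ⟨fun l => if l ∈ A then 1 else 0, c⟩

/-- **The IP₀ system** `(∑_{i∈A} nᵢ + c)_{A ⊆ [d], A ≠ ∅}` (`c = 0`: Example 3; `c = ±1`: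
Example 9). [cite: GreenTao2010, Examples 3 and 9] -/
def ipSystem (d : ℕ) (c : ℤ) : Fin (ipCount d) → AffLinForm d := fun k => subsetSumForm (ipSet k) c

/-- `ψ̇_A(f) = ∑_{i∈A} fᵢ`. [cite: GreenTao2010, Example 3] -/
@[simp] theorem linearPart_subsetSumForm (A : Finset (Fin d)) (c : ℤ) (f : Fin d → ℤ) :
    (subsetSumForm A c).linearPart f = ∑ i ∈ A, f i := by
  classical
  simp [subsetSumForm, AffLinForm.linearPart, ite_mul, Finset.sum_ite_mem, Finset.univ_inter]

/-- `ψ_A(0) = c`. [cite: GreenTao2010, Example 9] -/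
@[simp] theorem subsetSumForm_const (A : Finset (Fin d)) (c : ℤ) : (subsetSumForm A c).const = c :=
  rfl

/-- `ψ_A(n) = ∑_{i∈A} nᵢ + c`. [cite: GreenTao2010, Examples 3 and 9] -/
@[simp] theorem eval_subsetSumForm (A : Finset (Fin d)) (c : ℤ) (n : Fin d → ℤ) :
    (subsetSumForm A c).eval n = ∑ i ∈ A, n i + c := by
  rw [AffLinForm.eval_eq_linearPart_add_const, linearPart_subsetSumForm, subsetSumForm_const]

/-- The `k`-th form evaluated. [cite: GreenTao2010, Examples 3 and 9] -/
theorem eval_ipSystem (c : ℤ) (k : Fin (ipCount d)) (n : Fin d → ℤ) :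
    (ipSystem d c k).eval n = ∑ i ∈ ipSet k, n i + c :=
  eval_subsetSumForm _ _ _

/-- The `k`-th linear part. [cite: GreenTao2010, Example 3] -/
theorem linearPart_ipSystem (c : ℤ) (k : Fin (ipCount d)) (f : Fin d → ℤ) :
    (ipSystem d c k).linearPart f = ∑ i ∈ ipSet k, f i :=
  linearPart_subsetSumForm _ _ _

/-! ### Example 3: complexity at most `d − 1` -/

/-- **Green–Tao 2010, Example 3: the IP₀ system has complexity at most `d − 1`.** For the form
`ψ_S` cover the other forms `ψ_T` (`T ≠ S`) by `d` classes indexed by `i ∈ [d]`: for `i ∈ S`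
the class `{ψ_T : i ∉ T}` (witness `f = eᵢ`: `ψ̇_T(f) = 0`, `ψ̇_S(f) = 1`), for `i ∉ S` the class
`{ψ_T : T ⊋ S, i ∈ T}` (witness `f = e_a − eᵢ` with `a ∈ S`); a `T ≠ S` either misses some
`i ∈ S` or strictly contains `S`. [cite: GreenTao2010, Example 3 and Def. 1.5] -/
theorem complexity_ipSystem_le (hd : 1 ≤ d) (c : ℤ) :
    complexity (ipSystem d c) ≤ (d - 1 : ℕ) := by
  classical
  obtain ⟨e, rfl⟩ : ∃ e, d = e + 1 := ⟨d - 1, by omega⟩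
  rw [Nat.add_sub_cancel]
  refine complexity_le_coe_iff.mpr fun k => ?_
  set S := ipSet k with hS
  obtain ⟨a, ha⟩ := ipSet_nonempty k
  refine ⟨fun i : Fin (e + 1) => if i ∈ S then univ.filter (fun l => l ≠ k ∧ i ∉ ipSet l)
      else univ.filter (fun l => S ⊆ ipSet l ∧ i ∈ ipSet l), fun l hl => ?_, fun i => ?_⟩
  · -- cover
    have hne : ipSet l ≠ S := fun h => hl (ipSet_injective (h.trans hS))
    by_cases hsub : S ⊆ ipSet l
    · obtain ⟨i, hiT, hiS⟩ := Finset.exists_of_ssubset (lt_of_le_of_ne hsub (Ne.symm hne))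
      refine ⟨i, ?_⟩
      dsimp only
      rw [if_neg hiS]
      exact Finset.mem_filter.mpr ⟨Finset.mem_univ _, hsub, hiT⟩
    · obtain ⟨i, hiS, hiT⟩ := Finset.not_subset.mp hsub
      refine ⟨i, ?_⟩
      dsimp only
      rw [if_pos hiS]
      exact Finset.mem_filter.mpr ⟨Finset.mem_univ _, hl, hiT⟩
  · -- avoid
    dsimp only
    by_cases hiS : i ∈ S
    · rw [if_pos hiS]
      refine not_memAffLinSpan_of_witness (fun m => if m = i then 1 else 0) (fun l hl => ?_) ?_
      · have hl' := (Finset.mem_filter.mp hl).2.2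
        rw [linearPart_ipSystem, Finset.sum_ite_eq' (ipSet l) i, if_neg hl']
      · rw [linearPart_ipSystem, ← hS, Finset.sum_ite_eq' S i, if_pos hiS]
        exact one_ne_zero
    · rw [if_neg hiS]
      refine not_memAffLinSpan_of_witness
        (fun m => (if m = a then 1 else 0) - (if m = i then 1 else 0)) (fun l hl => ?_) ?_
      · obtain ⟨hsub, hiT⟩ := (Finset.mem_filter.mp hl).2
        rw [linearPart_ipSystem, Finset.sum_sub_distrib, Finset.sum_ite_eq' (ipSet l) a,
          Finset.sum_ite_eq' (ipSet l) i, if_pos (hsub ha), if_pos hiT, sub_self]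
      · rw [linearPart_ipSystem, ← hS, Finset.sum_sub_distrib, Finset.sum_ite_eq' S a,
          Finset.sum_ite_eq' S i, if_pos ha, if_neg hiS, sub_zero]
        exact one_ne_zero

/-! ### Example 9 from the Main Theorem at complexity `d − 1` -/

/-- The open convex cone `{0 < x₁ < x₂ < ⋯ < x_d}` (distinct positive coordinates, each tuple
counted once). [cite: GreenTao2010, Example 9] -/
def increasingCone (d : ℕ) : Set (Fin d → ℝ) :=
  {x | (∀ i, 0 < x i) ∧ ∀ i j, i < j → x i < x j}

/-- [folklore] -/
private theorem increasingCone_eq (d : ℕ) : increasingCone d =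
    ⋂ i : Fin d, ({x | 0 < x i} ∩ ⋂ j : Fin d, {x | i < j → x i < x j}) := by
  ext x
  simp only [increasingCone, Set.mem_setOf_eq, Set.mem_iInter, Set.mem_inter_iff]
  exact ⟨fun ⟨h1, h2⟩ i => ⟨h1 i, fun j => h2 i j⟩, fun h => ⟨fun i => (h i).1, fun i j => (h i).2 j⟩⟩

/-- The cone is open. [cite: GreenTao2010, Example 9] -/
theorem isOpen_increasingCone (d : ℕ) : IsOpen (increasingCone d) := by
  rw [increasingCone_eq]
  refine isOpen_iInter_of_finite fun i => (isOpen_lt continuous_const (continuous_apply i)).inter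
    (isOpen_iInter_of_finite fun j => ?_)
  by_cases hij : i < j
  · simpa [hij] using isOpen_lt (continuous_apply i) (continuous_apply j)
  · simp [hij]

/-- The cone is convex. [cite: GreenTao2010, Example 9] -/
theorem convex_increasingCone (d : ℕ) : Convex ℝ (increasingCone d) := by
  intro x hx y hy a b ha hb hab
  obtain ⟨hx1, hx2⟩ := hx
  obtain ⟨hy1, hy2⟩ := hy
  simp only [increasingCone, Set.mem_setOf_eq, Pi.add_apply, Pi.smul_apply, smul_eq_mul]
  refine ⟨fun i => ?_, fun i j hij => ?_⟩
  · have := hx1 i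
    have := hy1 i
    rcases ha.eq_or_lt with rfl | ha'
    · rw [zero_add] at hab; subst hab; simpa using hy1 i
    · nlinarith
  · have := hx2 i j hij
    have := hy2 i j hij
    rcases ha.eq_or_lt with rfl | ha'
    · rw [zero_add] at hab; subst hab; simpa using hy2 i j hij
    · nlinarith

/-- The cone is closed under positive dilations. [cite: GreenTao2010, Example 9] -/
theorem smul_mem_increasingCone {d : ℕ} {r : ℝ} (hr : 0 < r) {x : Fin d → ℝ}
    (hx : x ∈ increasingCone d) : r • x ∈ increasingCone d := by
  obtain ⟨hx1, hx2⟩ := hx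
  refine ⟨fun i => ?_, fun i j hij => ?_⟩
  · simpa using mul_pos hr (hx1 i)
  · simpa using mul_lt_mul_of_pos_left (hx2 i j hij) hr

/-- No local obstruction for `c = ±1`: at `n = 0` every form equals `c`.
[cite: GreenTao2010, Example 9] -/
theorem ipSystem_locallySolvable {c : ℤ} (hc : c = 1 ∨ c = -1) (p : ℕ) (hp : p.Prime) :
    ∃ n : Fin d → ℤ, ∀ k, ¬ ((p : ℤ) ∣ (ipSystem d c k).eval n) := by
  refine ⟨fun _ => 0, fun k h => ?_⟩
  rw [eval_ipSystem] at h
  simp only [Finset.sum_const_zero, zero_add] at h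
  have h1 : (p : ℤ) ∣ 1 := by
    rcases hc with rfl | rfl
    · exact h
    · exact (dvd_neg.mpr h).trans (by norm_num)
  have : p ∣ 1 := by exact_mod_cast Int.natAbs_dvd_natAbs.mpr h1
  exact hp.ne_one (Nat.dvd_one.mp this)

/-- **Green–Tao 2010, Example 9 (`P − 1` and `P + 1` are IP₀-sets), from the Main Theorem at
complexity `d − 1`.** Let `d ≥ 1`, `c ∈ {1, −1}`, and assume the Main Theorem for systems of
complexity `≤ d − 1` (Green–Tao's hypotheses `GI(d−1)`, `MN(d−1)` enter only through it). Then
there are infinitely many `d`-tuples `0 < n₁ < n₂ < ⋯ < n_d` of (distinct, positive) integers such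
that every subset sum `∑_{i∈A} nᵢ` (`A ≠ ∅`) is a prime minus `c`, i.e. `∑_{i∈A} nᵢ + c` is prime.
[cite: GreenTao2010, Example 9 and Cor. 1.9] -/
theorem GreenTao2010_example9 (hd : 1 ≤ d) {c : ℤ} (hc : c = 1 ∨ c = -1)
    (h : GreenTao2010_mainTheoremAtComplexity (d - 1)) :
    {n : Fin d → ℤ | (∀ i, 0 < n i) ∧ (∀ i j, i < j → n i < n j) ∧
      ∀ A : Finset (Fin d), A.Nonempty → (∑ i ∈ A, n i + c).toNat.Prime}.Infinite := by
  have hpos : ∃ n : Fin d → ℤ, realPoint n ∈ increasingCone d ∧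
      ∀ k, 0 < (ipSystem d c k).linearPart n := by
    refine ⟨fun i => (i : ℤ) + 1, ⟨fun i => ?_, fun i j hij => ?_⟩, fun k => ?_⟩
    · simp only [realPoint]; positivity
    · simp only [realPoint]
      have : (i : ℝ) < j := by exact_mod_cast hij
      push_cast; linarith
    · rw [linearPart_ipSystem]
      exact Finset.sum_pos (fun i _ => by positivity) (ipSet_nonempty k)
  have key := GreenTao2010_corollary19_of_mainTheoremAtComplexity h hd (one_le_ipCount hd)
    (ipSystem d c) (complexity_ipSystem_le hd c) (isOpen_increasingCone d)
    (convex_increasingCone d) (fun r hr x hx => smul_mem_increasingCone hr hx)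
    (ipSystem_locallySolvable hc) hpos
  refine key.mono fun n hn => ?_
  obtain ⟨⟨h1, h2⟩, h3⟩ := hn
  refine ⟨fun i => ?_, fun i j hij => ?_, fun A hA => ?_⟩
  · have := h1 i; simp only [realPoint] at this; exact_mod_cast this
  · have := h2 i j hij; simp only [realPoint] at this; exact_mod_cast this
  · obtain ⟨k, hk⟩ := exists_ipSet_eq hA
    have := h3 k
    rwa [eval_ipSystem, hk] at this

/-- **Example 9 at `d = 2` (unconditional, complexity `1`):** for `c ∈ {1, −1}` there are
infinitely many `0 < n₁ < n₂` with `n₁ + c`, `n₂ + c`, `n₁ + n₂ + c` all prime (the sums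
`n₁, n₂, n₁ + n₂` are all primes minus `c`). [cite: GreenTao2010, Example 9 (s = 1)] -/
theorem GreenTao2010_example9_two {c : ℤ} (hc : c = 1 ∨ c = -1) :
    {n : Fin 2 → ℤ | 0 < n 0 ∧ n 0 < n 1 ∧ (n 0 + c).toNat.Prime ∧ (n 1 + c).toNat.Prime ∧
      (n 0 + n 1 + c).toNat.Prime}.Infinite := by
  refine (GreenTao2010_example9 (d := 2) (by norm_num) hc
    GreenTao2010_mainTheoremAtComplexity_one).mono fun n hn => ?_
  obtain ⟨h1, h2, h3⟩ := hn
  refine ⟨h1 0, h2 0 1 (by decide), ?_, ?_, ?_⟩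
  · simpa using h3 {0} (by simp)
  · simpa using h3 {1} (by simp)
  · simpa [Finset.sum_pair (show (0 : Fin 2) ≠ 1 by decide)] using h3 {0, 1} (by simp)

/-- **Example 9 at `d = 3`, from `GI(2)` and `MN(2)`** — the statement Green–Tao display as the
new unconditional consequence of their work (here conditional on the named facts `GITwo`, `MNTwo`,
their inverse `U³` theorem and Möbius–nilsequences estimate): for `c ∈ {1, −1}` there are
infinitely many `0 < n₁ < n₂ < n₃` such that
`n₁, n₂, n₃, n₁+n₂, n₁+n₃, n₂+n₃, n₁+n₂+n₃` are all primes minus `c`.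
[cite: GreenTao2010, Example 9 (s = 2)] -/
theorem GreenTao2010_example9_three_of_GI_of_MN (hGI : GreenTaoLevelTwo.GITwo)
    (hMN : GreenTaoLevelTwo.MNTwo) {c : ℤ} (hc : c = 1 ∨ c = -1) :
    {n : Fin 3 → ℤ | 0 < n 0 ∧ n 0 < n 1 ∧ n 1 < n 2 ∧
      (n 0 + c).toNat.Prime ∧ (n 1 + c).toNat.Prime ∧ (n 2 + c).toNat.Prime ∧
      (n 0 + n 1 + c).toNat.Prime ∧ (n 0 + n 2 + c).toNat.Prime ∧ (n 1 + n 2 + c).toNat.Prime ∧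
      (n 0 + n 1 + n 2 + c).toNat.Prime}.Infinite := by
  refine (GreenTao2010_example9 (d := 3) (by norm_num) hc
    (GreenTao2010_mainTheoremAtComplexity_two_of_GI_of_MN hGI hMN)).mono fun n hn => ?_
  obtain ⟨h1, h2, h3⟩ := hn
  refine ⟨h1 0, h2 0 1 (by decide), h2 1 2 (by decide), ?_, ?_, ?_, ?_, ?_, ?_, ?_⟩
  · simpa using h3 {0} (by simp)
  · simpa using h3 {1} (by simp)
  · simpa using h3 {2} (by simp)
  · simpa [Finset.sum_pair (show (0 : Fin 3) ≠ 1 by decide)] using h3 {0, 1} (by simp)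
  · simpa [Finset.sum_pair (show (0 : Fin 3) ≠ 2 by decide)] using h3 {0, 2} (by simp)
  · simpa [Finset.sum_pair (show (1 : Fin 3) ≠ 2 by decide)] using h3 {1, 2} (by simp)
  · have := h3 {0, 1, 2} (by simp)
    simpa [Finset.sum_insert, add_assoc] using this

end Literature.NumberTheory.Sieve

end
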